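import Summits.QuantumFields.BalabanUV.T4Continuum.Support.NE7MinimalOrbitUniqueSU2
import Summits.QuantumFields.BalabanUV.T4Continuum.Support.NE7InteriorExistsSU2
import Summits.QuantumFields.BalabanUV.T4Continuum.Support.NE7EtaRegularGaugeInvariance
import Summits.QuantumFields.BalabanUV.T4Continuum.Support.AveragingDeficitKDatum
import HarnessLib

/-!
# NE7AllMinimisersRegularSU2 — (H∀)ᴱ FOR SU(2), d = 4, L = 2, NO DISPLAYED HYPOTHESIS: over the small data, EVERY constrained minimiser of `sfClass 4 2 N ε` at EVERY level is in the tree's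
# energy-regularity class `Regular 4 2 N ε g(ε)` (gen 104's (H∃)ᴱ `NE7InteriorExistsSU2.interior_exists_SU2` gave ONE such minimiser per level)

Cell `pub-balaban`, rung (B)+1 sub-cell t4, lineage `b2b-balaban-t4-ne7-p1`, generation 105 (CRUX PROVER NE7 #1 = OWNER of BINDER row NE7).  Memo `t4/b2b-balaban-t4-ne7-p1-g105/ROAD-G105.md` §7.
THE ARGUMENT.  The minimal set is one periodic unitary gauge orbit (`NE7MinimalOrbitUniqueSU2.minimal_orbit_unique_SU2`, this generation); (H∃)ᴱ supplies a `Regular` minimiser `U₀` in it; `Regular` is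
gauge invariant (`NE7EtaRegularGaugeInvariance.regular_gaugeAct`, radius `ε < 1`); so every minimiser `U′ = (U♯)^{u′⁻¹} = ((U₀)^{u₀})^{u′⁻¹}` is `Regular` with the same data.
WHAT ([folklore]; 0 def, 0 sorry).  **`all_minimisers_regular_SU2`**: `card n = 2 → ∃ ε₀ > 0, ∀ 0 < ε ≤ ε₀, ∀ N ≥ 1, ∃ δ_V > 0, ∀ V (unitary, N-periodic, SmallField V δ_V), ∀ k U,
IsMinimiser 4 (sfClass 4 2 N ε) 2 N k V U → Regular 4 2 N ε g(ε) k U`, `g(ε) = card n·(624·4³ε²(1+5ε)² + 6768·#Plane²·4·card n·ε⁴ + 16·4³ε²·2²) + 220·card n·4³·ε³` ((H∃)ᴱ's letter).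
HONEST FRAMING (page 1): composition of landed kernel theorems of this lineage; nothing of Bałaban's asserted as an axiom; `Regular` is the tree's ℓ²-type class (NOT the pointwise `RegularSup`, which stays
open); SU(2), `L = 2`, finite 4-torus, small data, constants existential; NOT NE7, NOT NE3; spine count = dagwriter∕referees' call; NOT infinite volume, NOT mass gap, NOT BetaPertH, NOT Clay.
-/

set_option autoImplicit false

open scoped BigOperators Matrix Matrix.Norms.L2Operator
open NormedSpace Finset Set

namespace Summit.QuantumFields.BalabanUV.T4Continuum.NE7AllMinimisersRegularSU2

open Literature.MathematicalPhysics.QuantumFieldTheory.Balaban1983to89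
open B7Prop1Explicit B7Prop2Explicit
open T4AveragingDeficitWall (IsUnitaryCfg SmallField)
open T4AveragingDeficitWallBoundary (IsPeriodicCfg)
open MinimalActionSandwich (IsMinimiser)
open MinimalActionRate (sfClass Regular)
open NE3EnergyShapes (IsUnitarySite IsPeriodicSite)
open NE7InteriorExistsSU2 (interior_exists_SU2)
open NE7MinimalOrbitUniqueSU2 (minimal_orbit_unique_SU2)
open NE7EtaRegularGaugeInvariance (regular_gaugeAct)
open NE7EtaMinimiserGaugeCovariance (isUnitarySite_inv isPeriodicSite_inv)
open AveragingDeficitKDatum (gaugeAct_inv_gaugeAct)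

noncomputable section

variable {n : Type} [Fintype n] [DecidableEq n]

/-- **(H∀)ᴱ FOR SU(2), `d = 4`, `L = 2`** (statement and argument in the file header). [folklore] -/
theorem all_minimisers_regular_SU2 [Nonempty n] (hn : Fintype.card n = 2) :
    ∃ ε₀ : ℝ, 0 < ε₀ ∧ ∀ ε : ℝ, 0 < ε → ε ≤ ε₀ → ∀ (N : ℕ) [NeZero N], 1 ≤ N →
      ∃ δV : ℝ, 0 < δV ∧
        ∀ V ∈ {V : Site 4 → Fin 4 → (Matrix n n ℂ)ˣ | IsUnitaryCfg V ∧ IsPeriodicCfg V (N : ℤ) ∧ SmallField V δV},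
        ∀ (k : ℕ) (U : Site 4 → Fin 4 → (Matrix n n ℂ)ˣ), IsMinimiser 4 (sfClass 4 2 N ε) 2 N k V U →
          Regular 4 2 N ε ((Fintype.card n : ℝ)
              * (624 * ((4 : ℕ) : ℝ) ^ 3 * ε ^ 2 * (1 + (((4 : ℕ) : ℝ) + 1) * ε) ^ 2
                  + 6768 * (Fintype.card (T4AveragingDeficitWall.Plane 4) : ℝ) ^ 2 * (4 : ℕ) * Fintype.card n * ε ^ 4
                  + 16 * ((4 : ℕ) : ℝ) ^ 3 * ε ^ 2 * ((2 : ℕ) : ℝ) ^ 2)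
            + 220 * (Fintype.card n : ℝ) * ((4 : ℕ) : ℝ) ^ 3 * ε ^ 3) k U := by
  obtain ⟨-, -, ε₁, hε₁, H1⟩ := interior_exists_SU2 (n := n) hn
  obtain ⟨ε₂, hε₂, H2⟩ := minimal_orbit_unique_SU2 (n := n) hn
  refine ⟨min ε₁ (min ε₂ (1 / 2)), lt_min hε₁ (lt_min hε₂ (by norm_num)), ?_⟩
  intro ε hε hεle N _ hN
  have hεε₁ : ε ≤ ε₁ := hεle.trans (min_le_left _ _)
  have hεε₂ : ε ≤ ε₂ := hεle.trans ((min_le_right _ _).trans (min_le_left _ _))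
  have hε1 : ε < 1 := by linarith [hεle.trans ((min_le_right _ _).trans (min_le_right _ _))]
  obtain ⟨β₀, hβ₀, H1'⟩ := H1 ε hε hεε₁
  obtain ⟨δ₁, hδ₁, hreg₁⟩ := H1' β₀ hβ₀ le_rfl N hN
  obtain ⟨δ₂, hδ₂, huniq⟩ := H2 ε hε hεε₂ N hN
  refine ⟨min δ₁ δ₂, lt_min hδ₁ hδ₂, ?_⟩
  intro V hV k U hU
  obtain ⟨hVu, hVP, hVδ⟩ := hV
  have hV₁ : V ∈ {V : Site 4 → Fin 4 → (Matrix n n ℂ)ˣ | IsUnitaryCfg V ∧ IsPeriodicCfg V (N : ℤ) ∧ SmallField V δ₁} :=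
    ⟨hVu, hVP, MinimalActionRate.SmallField.mono hVδ (min_le_left _ _)⟩
  have hV₂ : V ∈ {V : Site 4 → Fin 4 → (Matrix n n ℂ)ˣ | IsUnitaryCfg V ∧ IsPeriodicCfg V (N : ℤ) ∧ SmallField V δ₂} :=
    ⟨hVu, hVP, MinimalActionRate.SmallField.mono hVδ (min_le_right _ _)⟩
  -- the regular minimiser of (H∃)ᴱ and the orbit representative
  obtain ⟨U₀, hU₀, hreg₀⟩ := hreg₁ V hV₁ k
  obtain ⟨Us, -, horbit⟩ := huniq V hV₂ k
  obtain ⟨u₀, hu₀, hu₀P, hg₀⟩ := horbit U₀ hU₀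
  obtain ⟨u, hu, huP, hg⟩ := horbit U hU
  -- `U♯ = U₀^{u₀}` is regular, and `U = (U♯)^{u⁻¹}`
  have hregs := regular_gaugeAct (le_refl 1 |>.trans one_le_two) hε1 hreg₀ hu₀ hu₀P
  rw [hg₀] at hregs
  have hU' : U = gaugeAct (fun z => (u z)⁻¹) Us := by rw [← hg, gaugeAct_inv_gaugeAct]
  rw [hU']
  exact regular_gaugeAct (le_refl 1 |>.trans one_le_two) hε1 hregs (isUnitarySite_inv hu) (isPeriodicSite_inv huP)

end

end Summit.QuantumFields.BalabanUV.T4Continuum.NE7AllMinimisersRegularSU2
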